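import Summits.BirchSwinnertonDyer.BirchSwinnertonDyer.Theorems.SylvesterTwoHeegnerIndexCoupledDescentCebotarevHSYClauses
import Summits.BirchSwinnertonDyer.BirchSwinnertonDyer.Theorems.SylvesterTwoHeegnerIndexCoupledDescentF4Package
import HarnessLib

/-!
# (hL3a)/(hL3b) for a pair of short `j = 0` models at `p = 2` — the `[ζ]`-binders eliminated

k7t-c3x's `infinite_kolyvaginPrimes_ne_hsy` / `infinite_kolyvaginPrimes_line_hsy`
(`…CoupledDescentCebotarevHSYClauses`: the Čebotarev clauses (hL3a)/(hL3b) of the coupled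
`2`-descent `SylvesterTwoCoupledDescentAtTwo.selmerGroup_eq_bot_and_le_closure_of_coupledLeaves`,
crux `UpperOffV0HSYPlus`, stmt-BirchSwinnertonDyer-19804, for two curves `y² = x³ + b` over
`K = ℚ(ζ)`) take per curve six DISPLAYED `[ζ]`-data binders `φ / hφrel / hφ / fn / hfn / hcoe`
(an additive self-map `φ` of `X_K(K̄)`, `φ² + φ + 1 = 0`, acting as `(x, y) ↦ (ζ² x, y)`, and its
Galois-equivariant restriction `fn` to `X_K[2]`). They EXIST
(`SylvesterTwoCoupledDescentF4Package.exists_cm_data_two`: `φ :=` k-ty1's CM isogeny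
`JZero.exists_cm_isogeny_of_eq` as an additive map, `fn :=` its `codRestrict`); this file (planner
D418–D421) records the binder-free clauses `infinite_kolyvaginPrimes_ne_hsy'`
((hL3a): all twelve binders and the conjugation `c` gone), `infinite_kolyvaginPrimes_line_hsy'`
((hL3b): curve `A`'s binders gone; `B`'s stay, the clause being phrased with `H¹(fn_B)`) and
`exists_cmH1_infinite_kolyvaginPrimes_line_hsy` ((hL3b), package form: SOME `[ζ]`-data for `B`,
with `hφrel / hφ / hcoe` exported so that the bottom-class hypothesis (C4) can be checked against
them). Still displayed: «`t³ + a₆ ≠ 0` on `K`» per curve, the Kummer independence clauses, the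
levels, (C4). Theorem-only; nothing asserted on 19804; no label moves; BSD not claimed.
-/

set_option linter.dupNamespace false -- Summits modules are `Summit.<Summit>.<Problem>…` by design

noncomputable section

open scoped Classical
open WeierstrassCurve NumberField IsDedekindDomain Field
open Literature.NumberTheory.EllipticCurves Literature.NumberTheory.GaloisRepresentations
open Summit.BirchSwinnertonDyer.BirchSwinnertonDyer.Theorems.SylvesterTwoCoupledDescentF4Package

namespace Summit.BirchSwinnertonDyer.BirchSwinnertonDyer.Theorems.SylvesterTwoCoupledDescentCebotarev

variable {K : Type} [Field K] [NumberField K]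

variable {A B : WeierstrassCurve ℚ} [A.IsElliptic] [B.IsElliptic]

/-- **(hL3a) for two `j = 0` curves at `p = 2`, `[ζ]`-binders eliminated.**
`infinite_kolyvaginPrimes_ne_hsy` with the twelve binders supplied by `exists_cm_data_two` and the
conjugation `c` (`c ζ = ζ²`) by `JZero.exists_aut_apply_eq_sq`; displayed: `K` imaginary quadratic
with `ζ ∈ K`, the short models, «`t³ + a₆ ≠ 0` on `K`» ×2, Kummer independence ×2, the levels. -/
theorem infinite_kolyvaginPrimes_ne_hsy' {NA NB : ℕ} [NeZero NA] [NeZero NB]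
    (hK : IsImaginaryQuadratic K) {ζ : K} (hζ : IsPrimitiveRoot ζ 3)
    (hA1 : A.a₁ = 0) (hA2 : A.a₂ = 0) (hA3 : A.a₃ = 0) (hA4 : A.a₄ = 0)
    (hA6 : ∀ t : K, t ^ 3 + algebraMap ℚ K A.a₆ ≠ 0)
    (hZA : ∀ θ : AlgebraicClosure K, θ ^ 3 + algebraMap ℚ (AlgebraicClosure K) B.a₆ = 0 →
      ∀ t : AlgebraicClosure K, t ∈ IntermediateField.adjoin K {θ} →
        t ^ 3 + algebraMap ℚ (AlgebraicClosure K) A.a₆ ≠ 0)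
    (hB1 : B.a₁ = 0) (hB2 : B.a₂ = 0) (hB3 : B.a₃ = 0) (hB4 : B.a₄ = 0)
    (hB6 : ∀ t : K, t ^ 3 + algebraMap ℚ K B.a₆ ≠ 0)
    (hZB : ∀ θ : AlgebraicClosure K, θ ^ 3 + algebraMap ℚ (AlgebraicClosure K) A.a₆ = 0 →
      ∀ t : AlgebraicClosure K, t ∈ IntermediateField.adjoin K {θ} →
        t ^ 3 + algebraMap ℚ (AlgebraicClosure K) B.a₆ ≠ 0)
    (s : galH1Torsion (A.baseChange K) ((2 : ℕ) : ℤ))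
    (t : galH1Torsion (B.baseChange K) ((2 : ℕ) : ℤ)) :
    Set.Infinite {ℓ : ℕ | (ℓ.Prime ∧ ¬ ℓ ∣ NA ∧ ¬ ℓ ∣ NB ∧ ¬ ((ℓ : ℤ) ∣ NumberField.discr K) ∧
        ℓ ≠ 2 ∧ (Ideal.span {(ℓ : 𝓞 K)}).IsPrime ∧
        FrobEqFrobInfty A K 2 ℓ ∧ FrobEqFrobInfty B K 2 ℓ) ∧
      ∀ v : HeightOneSpectrum (𝓞 K), (ℓ : 𝓞 K) ∈ v.asIdeal →
        (s ≠ 0 → s ∉ (A.baseChange K).torsionLocalKer (v.adicCompletion K) ((2 : ℕ) : ℤ)) ∧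
        (t ≠ 0 → t ∉ (B.baseChange K).torsionLocalKer (v.adicCompletion K) ((2 : ℕ) : ℤ))} := by
  -- the conjugation `c` of `K = ℚ(ζ)` (`c ζ = ζ²`), from `ζ² + ζ + 1 = 0` and `[K : ℚ] = 2`
  have hω : ζ ^ 2 + ζ + 1 = 0 := by
    have h := hζ.pow_eq_one
    have h1 : ζ - 1 ≠ 0 := sub_ne_zero.mpr (hζ.ne_one (by norm_num))
    have : (ζ - 1) * (ζ ^ 2 + ζ + 1) = 0 := by linear_combination h
    simpa [h1] using this
  obtain ⟨-, -, c, hcζ, -⟩ := JZero.exists_aut_apply_eq_sq K hω hK.1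
  obtain ⟨φA, fnA, hφArel, hφA, hfnA, hcoeA⟩ := exists_cm_data_two (K := K) A hA1 hA2 hA3 hA4 hζ
  obtain ⟨φB, fnB, hφBrel, hφB, hfnB, hcoeB⟩ := exists_cm_data_two (K := K) B hB1 hB2 hB3 hB4 hζ
  exact infinite_kolyvaginPrimes_ne_hsy hK hζ hcζ hA1 hA2 hA3 hA4 hA6 φA hφArel hφA fnA hfnA hcoeA
    hZA hB1 hB2 hB3 hB4 hB6 φB hφBrel hφB fnB hfnB hcoeB hZB s t

/-- **(hL3b) for two `j = 0` curves at `p = 2`, curve `A`'s `[ζ]`-binders eliminated** (by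
`exists_cm_data_two`); curve `B`'s six binders stay (the clause is phrased with `H¹(fn_B)`). -/
theorem infinite_kolyvaginPrimes_line_hsy' {NA NB : ℕ} [NeZero NA] [NeZero NB]
    (hK : IsImaginaryQuadratic K) {ζ : K} (hζ : IsPrimitiveRoot ζ 3) {c : K ≃ₐ[ℚ] K}
    (hcζ : c ζ = ζ ^ 2)
    (hA1 : A.a₁ = 0) (hA2 : A.a₂ = 0) (hA3 : A.a₃ = 0) (hA4 : A.a₄ = 0)
    (hA6 : ∀ t : K, t ^ 3 + algebraMap ℚ K A.a₆ ≠ 0)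
    (hZA : ∀ θ : AlgebraicClosure K, θ ^ 3 + algebraMap ℚ (AlgebraicClosure K) B.a₆ = 0 →
      ∀ t : AlgebraicClosure K, t ∈ IntermediateField.adjoin K {θ} →
        t ^ 3 + algebraMap ℚ (AlgebraicClosure K) A.a₆ ≠ 0)
    (hB1 : B.a₁ = 0) (hB2 : B.a₂ = 0) (hB3 : B.a₃ = 0) (hB4 : B.a₄ = 0)
    (hB6 : ∀ t : K, t ^ 3 + algebraMap ℚ K B.a₆ ≠ 0)
    (φB : geomPoints (B.baseChange K) →+ geomPoints (B.baseChange K))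
    (hφBrel : ∀ P, φB (φB P) + φB P + P = 0)
    (hφB : ∀ (x y : AlgebraicClosure K)
      (h : ((B.baseChange K).baseChange (AlgebraicClosure K)).toAffine.Nonsingular x y),
      ∃ h', φB (Affine.Point.some x y h) =
        Affine.Point.some (algebraMap K (AlgebraicClosure K) ζ ^ 2 * x) y h')
    (fnB : geomTorsion (B.baseChange K) ((2 : ℕ) : ℤ) →+ geomTorsion (B.baseChange K) ((2 : ℕ) : ℤ))
    (hfnB : ∀ (σ : absoluteGaloisGroup K) (P : geomTorsion (B.baseChange K) ((2 : ℕ) : ℤ)),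
      fnB (ContinuousMonoidHom.id _ σ • P) = σ • fnB P)
    (hcoeB : ∀ P : geomTorsion (B.baseChange K) ((2 : ℕ) : ℤ),
      ((fnB P : geomTorsion (B.baseChange K) ((2 : ℕ) : ℤ)) : geomPoints (B.baseChange K)) = φB P)
    (hZB : ∀ θ : AlgebraicClosure K, θ ^ 3 + algebraMap ℚ (AlgebraicClosure K) A.a₆ = 0 →
      ∀ t : AlgebraicClosure K, t ∈ IntermediateField.adjoin K {θ} →
        t ^ 3 + algebraMap ℚ (AlgebraicClosure K) B.a₆ ≠ 0)
    (y x₁ : galH1Torsion (B.baseChange K) ((2 : ℕ) : ℤ))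
    (hx₁ : conjAct B c ((2 : ℕ) : ℤ) x₁ = x₁)
    (hyx : ∃ α β : ℤ, y = α • x₁ + β • resH1Hom (ContinuousMonoidHom.id _) fnB hfnB x₁)
    (hxy : ∀ a b : ℤ, ∃ a' b' : ℤ,
      a • x₁ + b • resH1Hom (ContinuousMonoidHom.id _) fnB hfnB x₁ =
        a' • y + b' • resH1Hom (ContinuousMonoidHom.id _) fnB hfnB y)
    (s : galH1Torsion (B.baseChange K) ((2 : ℕ) : ℤ))
    (hs : ¬ ∃ a b : ℤ, s = a • y + b • resH1Hom (ContinuousMonoidHom.id _) fnB hfnB y)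
    (cl : galH1Torsion (A.baseChange K) ((2 : ℕ) : ℤ)) (hcl : cl ≠ 0) :
    Set.Infinite {ℓ : ℕ | (ℓ.Prime ∧ ¬ ℓ ∣ NA ∧ ¬ ℓ ∣ NB ∧ ¬ ((ℓ : ℤ) ∣ NumberField.discr K) ∧
        ℓ ≠ 2 ∧ (Ideal.span {(ℓ : 𝓞 K)}).IsPrime ∧
        FrobEqFrobInfty A K 2 ℓ ∧ FrobEqFrobInfty B K 2 ℓ) ∧
      ∀ v : HeightOneSpectrum (𝓞 K), (ℓ : 𝓞 K) ∈ v.asIdeal →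
        y ∈ (B.baseChange K).torsionLocalKer (v.adicCompletion K) ((2 : ℕ) : ℤ) ∧
        s ∉ (B.baseChange K).torsionLocalKer (v.adicCompletion K) ((2 : ℕ) : ℤ) ∧
        cl ∉ (A.baseChange K).torsionLocalKer (v.adicCompletion K) ((2 : ℕ) : ℤ)} := by
  obtain ⟨φA, fnA, hφArel, hφA, hfnA, hcoeA⟩ := exists_cm_data_two (K := K) A hA1 hA2 hA3 hA4 hζ
  exact infinite_kolyvaginPrimes_line_hsy hK hζ hcζ hA1 hA2 hA3 hA4 hA6 φA hφArel hφA fnA hfnA hcoeA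
    hZA hB1 hB2 hB3 hB4 hB6 φB hφBrel hφB fnB hfnB hcoeB hZB y x₁ hx₁ hyx hxy s hs cl hcl

/-- **(hL3b) for two `j = 0` curves at `p = 2`, package form.** There are `[ζ]`-data
`φB / fnB / hfnB` for `B` — with their characterising properties exported: `φB² + φB + 1 = 0`,
`φB (x, y) = (ζ² x, y)` on affine points, `↑(fnB P) = φB ↑P` — such that, writing
`wH := H¹(fnB) = resH1Hom id fnB hfnB`, clause (hL3b) holds: for every bottom class `y` with a
`σ`-fixed generator `x₁` of its `𝔽₄`-line (C4), every `s` off that line and every `cl ≠ 0`,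
infinitely many Kolyvagin primes with `y_λ = 0`, `s_λ ≠ 0`, `cl_λ ≠ 0`. -/
theorem exists_cmH1_infinite_kolyvaginPrimes_line_hsy {NA NB : ℕ} [NeZero NA] [NeZero NB]
    (hK : IsImaginaryQuadratic K) {ζ : K} (hζ : IsPrimitiveRoot ζ 3) {c : K ≃ₐ[ℚ] K}
    (hcζ : c ζ = ζ ^ 2)
    (hA1 : A.a₁ = 0) (hA2 : A.a₂ = 0) (hA3 : A.a₃ = 0) (hA4 : A.a₄ = 0)
    (hA6 : ∀ t : K, t ^ 3 + algebraMap ℚ K A.a₆ ≠ 0)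
    (hZA : ∀ θ : AlgebraicClosure K, θ ^ 3 + algebraMap ℚ (AlgebraicClosure K) B.a₆ = 0 →
      ∀ t : AlgebraicClosure K, t ∈ IntermediateField.adjoin K {θ} →
        t ^ 3 + algebraMap ℚ (AlgebraicClosure K) A.a₆ ≠ 0)
    (hB1 : B.a₁ = 0) (hB2 : B.a₂ = 0) (hB3 : B.a₃ = 0) (hB4 : B.a₄ = 0)
    (hB6 : ∀ t : K, t ^ 3 + algebraMap ℚ K B.a₆ ≠ 0)
    (hZB : ∀ θ : AlgebraicClosure K, θ ^ 3 + algebraMap ℚ (AlgebraicClosure K) A.a₆ = 0 →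
      ∀ t : AlgebraicClosure K, t ∈ IntermediateField.adjoin K {θ} →
        t ^ 3 + algebraMap ℚ (AlgebraicClosure K) B.a₆ ≠ 0) :
    ∃ (φB : geomPoints (B.baseChange K) →+ geomPoints (B.baseChange K))
      (fnB : geomTorsion (B.baseChange K) ((2 : ℕ) : ℤ) →+
        geomTorsion (B.baseChange K) ((2 : ℕ) : ℤ))
      (hfnB : ∀ (σ : absoluteGaloisGroup K) (P : geomTorsion (B.baseChange K) ((2 : ℕ) : ℤ)),
        fnB (ContinuousMonoidHom.id _ σ • P) = σ • fnB P),
      (∀ P, φB (φB P) + φB P + P = 0) ∧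
      (∀ (x y : AlgebraicClosure K)
        (h : ((B.baseChange K).baseChange (AlgebraicClosure K)).toAffine.Nonsingular x y),
        ∃ h', φB (Affine.Point.some x y h) =
          Affine.Point.some (algebraMap K (AlgebraicClosure K) ζ ^ 2 * x) y h') ∧
      (∀ P : geomTorsion (B.baseChange K) ((2 : ℕ) : ℤ),
        ((fnB P : geomTorsion (B.baseChange K) ((2 : ℕ) : ℤ)) : geomPoints (B.baseChange K)) =
          φB P) ∧
      ∀ (y x₁ : galH1Torsion (B.baseChange K) ((2 : ℕ) : ℤ)),
        conjAct B c ((2 : ℕ) : ℤ) x₁ = x₁ →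
        (∃ α β : ℤ, y = α • x₁ + β • resH1Hom (ContinuousMonoidHom.id _) fnB hfnB x₁) →
        (∀ a b : ℤ, ∃ a' b' : ℤ,
          a • x₁ + b • resH1Hom (ContinuousMonoidHom.id _) fnB hfnB x₁ =
            a' • y + b' • resH1Hom (ContinuousMonoidHom.id _) fnB hfnB y) →
        ∀ s : galH1Torsion (B.baseChange K) ((2 : ℕ) : ℤ),
          (¬ ∃ a b : ℤ, s = a • y + b • resH1Hom (ContinuousMonoidHom.id _) fnB hfnB y) →
          ∀ cl : galH1Torsion (A.baseChange K) ((2 : ℕ) : ℤ), cl ≠ 0 →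
            Set.Infinite {ℓ : ℕ | (ℓ.Prime ∧ ¬ ℓ ∣ NA ∧ ¬ ℓ ∣ NB ∧
                ¬ ((ℓ : ℤ) ∣ NumberField.discr K) ∧ ℓ ≠ 2 ∧ (Ideal.span {(ℓ : 𝓞 K)}).IsPrime ∧
                FrobEqFrobInfty A K 2 ℓ ∧ FrobEqFrobInfty B K 2 ℓ) ∧
              ∀ v : HeightOneSpectrum (𝓞 K), (ℓ : 𝓞 K) ∈ v.asIdeal →
                y ∈ (B.baseChange K).torsionLocalKer (v.adicCompletion K) ((2 : ℕ) : ℤ) ∧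
                s ∉ (B.baseChange K).torsionLocalKer (v.adicCompletion K) ((2 : ℕ) : ℤ) ∧
                cl ∉ (A.baseChange K).torsionLocalKer (v.adicCompletion K) ((2 : ℕ) : ℤ)} := by
  obtain ⟨φB, fnB, hφBrel, hφB, hfnB, hcoeB⟩ := exists_cm_data_two (K := K) B hB1 hB2 hB3 hB4 hζ
  exact ⟨φB, fnB, hfnB, hφBrel, hφB, hcoeB, fun y x₁ hx₁ hyx hxy s hs cl hcl ↦
    infinite_kolyvaginPrimes_line_hsy' hK hζ hcζ hA1 hA2 hA3 hA4 hA6 hZA hB1 hB2 hB3 hB4 hB6 φB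
      hφBrel hφB fnB hfnB hcoeB hZB y x₁ hx₁ hyx hxy s hs cl hcl⟩

end Summit.BirchSwinnertonDyer.BirchSwinnertonDyer.Theorems.SylvesterTwoCoupledDescentCebotarev

end
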